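import Summits.Ventures.CertifiedManyBodySolver.Downfold.RouterWordScoreV8Prereg

/-!
# The v8 slate M298–M346 and the FREEZE-NIGHT prints: score-2's pre-registered router-word readings
# (PREREG §E 2026-08-27T23:04Z / 2026-08-28T00:5xZ–01:0xZ, by reference to Y87) as kernel facts of the §4.2 score

Venture CertifiedManyBodySolver, cell `pub/hubbard-downfold`, seat hubbard-downfold-score-2 (g13); namespace
`Summit.Ventures.CertifiedManyBodySolver.Downfold.RouterScore` (REUSES `score`, `Head`, `Outcome`, `outcome`, `fullMatch`,
`primaryEmitted`, `expectsStructural` of `RouterWordScore.lean` and the §1 lemma of `RouterWordScoreV8Prereg.lean`).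
Context: on the night of the 2026-08-28 D2 truth freeze the validation-set tranche v8 (the programme's OUT-OF-SAMPLE
router-word table «MO-PRED-1», 137 → 141 materials) grew by the rows M298–M346 — heavy-fermion controls, sp / filled-d
conventional metals, 4d/5d-manifold intermetallics, trilayer cuprates, Fe-pnictides, the tetradymite trio, T′-trilayer
nickelates, Cu-intercalated Bi₂Se₃, the BaH₁₂ superhydride, the CsV₃Sb₅ kagome metal — each with EXPECTED router words typed
by the curators before any descriptor run. score-2 registered BY REFERENCE what every plausible print SCORES and PRE-NAMED the
at-risk print shape per class BEFORE any word on these rows existed (python engine `router_score.py score <id> <P> <word>`;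
every case below checked there first). §1 is the one new structural lemma these readings use — a bare typed PRIMARY printed
ALONE scores `PARTIAL` whenever every alternative led by it carries a further token (the «typed secondary missing» shape of
BaH₁₂ / CuₓBi₂Se₃ / CsV₃Sb₅); §2 are the class readings; §3 records the prints of the night against them (the hits).

WHAT THIS IS NOT: not a word, not a prediction that any material prints these words, not a score of record (v8 rows are written
once at the lead's «v8 CLOSE», never pooled with the calibration R), and not physics. Material names appear only in docstrings.
Open-grammar / mixed-case heads (ACCEPTANCE v1.9 item 17: `UND:HF-candidate`, `UND:DISORDER`) are written `other n`.
-/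

namespace Summit.Ventures.CertifiedManyBodySolver.Downfold

namespace RouterScore

/-! ## §1 A bare typed primary printed alone, when every alternative it leads has a companion, is `PARTIAL` -/

section lemma_

variable {α : Type*} [DecidableEq α] (structural : α → Bool)

/-- «Typed secondary missing»: the emitted word is the single non-structural head `p`; some registered alternative is LED by
`p`, but no alternative is fully covered by `[p]` (each `p`-led alternative carries a further token) ⇒ the §4.2 score is
`PARTIAL` — clause 3 fails, clause 4 fires on the `p`-led alternative. [folklore] -/
theorem outcome_singleton_partial {p : α} {alts : List (List α)}
    (hs : structural p = false)
    (hled : ∃ a ∈ alts, a.head? = some p)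
    (hnofull : ∀ a ∈ alts, fullMatch [p] a = false) :
    outcome structural [p] alts = .PARTIAL := by
  obtain ⟨a, ha, hpa⟩ := hled
  have halts : alts ≠ [] := List.ne_nil_of_mem ha
  have hfull : alts.any (fullMatch [p]) = false := by
    rw [List.any_eq_false]
    intro b hb h
    simp [hnofull b hb] at h
  have hprim : alts.any (primaryEmitted [p]) = true :=
    List.any_eq_true.mpr ⟨a, ha, by unfold primaryEmitted; rw [hpa]; simp⟩
  rw [outcome_cons, if_neg halts, hs, Bool.false_and, if_neg (by decide), hfull, if_neg (by decide), if_pos hprim]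

end lemma_

open Head

/-! ## §2 The class readings registered 2026-08-27T23:04Z / 2026-08-28T00:5xZ–01:0xZ (by reference to Y87) -/

/-- (a) heavy-fermion rows typed «UND:HF» (M299 UPd₂Al₃ · M301 CePd₂Si₂ · M302 CeCu₆ · M303 CeAl₃ · M311 PrOs₄Sb₁₂ · M323 URhGe ·
M337 CeRh₂As₂): «UND:HF(…)» ⇒ AGREE; the PRE-NAMED honesty-slot shapes — a word-bearing f-in-core leg printing a d/sp word
«EPH» or «UND:MIXED+EPH» ⇒ DISAGREE; a coded «UND:HF-candidate(…)» head (`other 1`, v1.9 item 17) with «UND:HF» riding ⇒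
PARTIAL, without it ⇒ DISAGREE. [folklore] -/
theorem v8late_heavy_fermion : score [undHF] [[undHF]] = .AGREE ∧ score [eph] [[undHF]] = .DISAGREE
    ∧ score [undMixed, eph] [[undHF]] = .DISAGREE ∧ score [other 1, undHF] [[undHF]] = .PARTIAL
    ∧ score [other 1, undMixed, eph] [[undHF]] = .DISAGREE := by decide

/-- (b) sp / filled-d metals typed «EPH» (M300 CaBi₂ · M309 NaAlSi ×3 · M310 NaAlGe · M312 NaBi · M320 CaSn₃ · M335 NaSn₂As₂):
«EPH(+SA)» ⇒ AGREE; no straddle shape was pre-named; an «UND:STRUCT…» PRIMARY ⇒ ABSTAIN_structure. (The 4d/5d-manifold «EPH»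
rows M304/M305/M313/M315–M319/M321/M328/M332/M334 carry the R3c-straddle reading `v8_dmetal_eph` of the g12 file.) [folklore] -/
theorem v8late_sp_eph : score [eph, sa] [[eph]] = .AGREE ∧ score [undStruct, eph] [[eph]] = .ABSTAIN_structure := by decide

/-- (b′) M328 CeRu₂ (typed «EPH» with itinerant Ce-4f): the mirror of the honesty slot — the R2 f-test firing prints «UND:HF(…)+EPH»
⇒ PARTIAL (EPH rides), «UND:HF(…)» alone ⇒ DISAGREE. [folklore] -/
theorem v8late_ceru2 : score [undHF, eph] [[eph]] = .PARTIAL ∧ score [undHF] [[eph]] = .DISAGREE := by decide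

/-- (c) TRILAYER cuprates typed «1BH+3BE» (M306 Tl-2223 ×2 · M307 Bi-2223 · M314 Tl-1223): «1BH+3BE(+EPH)(+BILAYER-1BH)» ⇒ AGREE; the
two PRE-NAMED shapes — the D3-MULTISITE OP/IP interval form «UND:MIXED(w_d…)+UND:MIXED(…)+EPH+1BH+3BE+1BH(@IP)+3BE(@IP)» and the
U-school straddle «UND:MIXED+1BH+3BE+EPH» ⇒ PARTIAL; a modulation «UND:STRUCT…» PRIMARY ⇒ ABSTAIN_structure. [folklore] -/
theorem v8late_trilayer_cuprate : score [bh1, be3, eph, bilayer1bh] [[bh1, be3]] = .AGREE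
    ∧ score [undMixed, undMixed, eph, bh1, be3, bh1, be3] [[bh1, be3]] = .PARTIAL
    ∧ score [undMixed, bh1, be3, eph] [[bh1, be3]] = .PARTIAL
    ∧ score [undStruct, bh1, be3] [[bh1, be3]] = .ABSTAIN_structure := by decide

/-- (d) the tetradymite trio M324 Bi₂Se₃ / M325 Bi₂Te₃ / M326 Sb₂Te₃ typed «EPH | EPH+UND:STRUCT | BI»: «BI(…)» or «EPH(+UND:STRUCT)»
⇒ AGREE; the PRE-NAMED high-P shape, an «UND:STRUCT…» PRIMARY on a P-induced phase ⇒ ABSTAIN_structure (UND:STRUCT is typed only as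
a secondary). [folklore] -/
theorem v8late_tetradymite : score [bi] [[eph], [eph, undStruct], [bi]] = .AGREE
    ∧ score [eph, undStruct] [[eph], [eph, undStruct], [bi]] = .AGREE
    ∧ score [undStruct, eph] [[eph], [eph, undStruct], [bi]] = .ABSTAIN_structure := by decide

/-- (e) M345 CuₓBi₂Se₃ typed «UND:MIXED+EPH | EPH+UND:STRUCT» (both primaries typed): either typed print ⇒ AGREE; «EPH» ALONE ⇒ PARTIAL
(§1: the typed secondary is missing); an «UND:STRUCT…» PRIMARY ⇒ ABSTAIN_structure; an «UND:DISORDER(…)» primary (`other 0`) with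
EPH riding ⇒ PARTIAL. [folklore] -/
theorem v8late_cuxbi2se3 : score [undMixed, eph] [[undMixed, eph], [eph, undStruct]] = .AGREE
    ∧ score [eph, undStruct] [[undMixed, eph], [eph, undStruct]] = .AGREE
    ∧ score [eph] [[undMixed, eph], [eph, undStruct]] = .PARTIAL
    ∧ score [undStruct, eph] [[undMixed, eph], [eph, undStruct]] = .ABSTAIN_structure
    ∧ score [other 0, eph] [[undMixed, eph], [eph, undStruct]] = .PARTIAL := by decide

/-- (e′) the «EPH alone ⇒ PARTIAL» entry of (e) is an instance of §1, not a case-by-case accident. [folklore] -/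
example : score [eph] [[undMixed, eph], [eph, undStruct]] = .PARTIAL :=
  outcome_singleton_partial Head.structural rfl ⟨[eph, undStruct], by simp, rfl⟩ (by decide)

/-- (f) M344 BaH₁₂ typed «EPH+UND:STRUCT | UND:STRUCT» — UND:STRUCT IS a typed PRIMARY here, so a structural head does NOT abstain:
«EPH+UND:STRUCT» and «UND:STRUCT(…)+EPH» ⇒ AGREE; «EPH» alone ⇒ PARTIAL (§1); the PRE-NAMED Ba-5d straddle «UND:MIXED+EPH+UND:STRUCT»
⇒ PARTIAL; an A6-ii comparator head «UND:HF-candidate(…)» (`other 1`) leading ⇒ PARTIAL iff EPH/UND:STRUCT ride. [folklore] -/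
theorem v8late_bah12 : score [eph, undStruct] [[eph, undStruct], [undStruct]] = .AGREE
    ∧ score [undStruct, eph] [[eph, undStruct], [undStruct]] = .AGREE
    ∧ score [eph] [[eph, undStruct], [undStruct]] = .PARTIAL
    ∧ score [undMixed, eph, undStruct] [[eph, undStruct], [undStruct]] = .PARTIAL
    ∧ score [other 1, undMixed, eph] [[eph, undStruct], [undStruct]] = .PARTIAL := by decide

/-- (g) M346 CsV₃Sb₅ typed «EPH+UND:STRUCT | UND:MIXED+EPH» (registered as a CLASS before the promotion, read concretely after):
«EPH+UND:STRUCT(CDW)» / «UND:MIXED(…)+EPH» ⇒ AGREE; «EPH» alone ⇒ PARTIAL; «UND:STRUCT(CDW)+EPH» (structural PRIMARY, not typed as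
one) ⇒ ABSTAIN_structure; a V-3d «UND:MULTIORB(…)+EPH» head ⇒ PARTIAL (EPH rides). [folklore] -/
theorem v8late_csv3sb5 : score [eph, undStruct] [[eph, undStruct], [undMixed, eph]] = .AGREE
    ∧ score [undMixed, eph] [[eph, undStruct], [undMixed, eph]] = .AGREE
    ∧ score [eph] [[eph, undStruct], [undMixed, eph]] = .PARTIAL
    ∧ score [undStruct, eph] [[eph, undStruct], [undMixed, eph]] = .ABSTAIN_structure
    ∧ score [undMultiorb, eph] [[eph, undStruct], [undMixed, eph]] = .PARTIAL := by decide

/-- (h) T′-trilayer nickelate controls M330 Pr₄Ni₃O₈ / M331 La₄Ni₃O₈ typed «1BH | 1BH+UND:MULTIORB | UND:MULTIORB»: per-site decided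
words «1BH+3BE+1BH(@Ni_inner)+3BE(@Ni_inner)» ⇒ AGREE (the print of 2026-08-28T01:37Z); the PRE-NAMED inner/outer INTERVAL form
«UND:MIXED(…)+UND:MIXED(…)+1BH+3BE» and the U-school straddle «UND:MIXED+1BH+3BE» ⇒ PARTIAL; «UND:MULTIORB(…)» ⇒ AGREE. [folklore] -/
theorem v8late_trilayer_nickelate : score [bh1, be3, bh1, be3] [[bh1], [bh1, undMultiorb], [undMultiorb]] = .AGREE
    ∧ score [undMixed, undMixed, bh1, be3] [[bh1], [bh1, undMultiorb], [undMultiorb]] = .PARTIAL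
    ∧ score [undMixed, bh1, be3] [[bh1], [bh1, undMultiorb], [undMultiorb]] = .PARTIAL
    ∧ score [undMultiorb] [[bh1], [bh1, undMultiorb], [undMultiorb]] = .AGREE := by decide

/-- (i) M336 K₂Cr₃As₃ (and the sibling M339 Rb₂Cr₃As₃) typed «UND:MULTIORB | UND:MULTIORB+EPH | UND:MULTIORB+UND:STRUCT»:
«UND:MULTIORB(…)(+EPH)» ⇒ AGREE; the PRE-NAMED quasi-1D «UND:LATTICE(…)» PRIMARY ⇒ PARTIAL with MULTIORB riding, DISAGREE alone;
the moment-straddle composite «UND:MIXED(m…)+UND:MULTIORB» ⇒ PARTIAL. [folklore] -/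
theorem v8late_k2cr3as3 : score [undMultiorb, eph] [[undMultiorb], [undMultiorb, eph], [undMultiorb, undStruct]] = .AGREE
    ∧ score [undLattice, undMultiorb] [[undMultiorb], [undMultiorb, eph], [undMultiorb, undStruct]] = .PARTIAL
    ∧ score [undLattice] [[undMultiorb], [undMultiorb, eph], [undMultiorb, undStruct]] = .DISAGREE
    ∧ score [undMixed, undMultiorb] [[undMultiorb], [undMultiorb, eph], [undMultiorb, undStruct]] = .PARTIAL := by decide

/-! ## §3 The prints of the freeze night against the registered readings (PREREG §E 2026-08-28T00:29Z–01:37Z) -/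

/-- The HITS: M332 Mo₃Al₂C, M234 Mg₄Pt₃H₆ ×2, M252 Li-ZrNCl, M264 Li₂Pd₃B, M265 Li₂Pt₃B all printed the PRE-NAMED 4d/5d straddle
«UND:MIXED+EPH» against «EPH» ⇒ PARTIAL (`v8_dmetal_eph`.1); M263 La₂PrNi₂O₇ ×3 printed «UND:MULTIORB(k=2…)» against
«UND:MULTIORB | UND:MULTIORB+UND:STRUCT» ⇒ AGREE; M324/M325/M326 printed «BI» ⇒ AGREE (`v8late_tetradymite`.1); M330/M331 printed the
per-site «1BH+3BE+…» ⇒ AGREE (`v8late_trilayer_nickelate`.1); and M287 La₄H₂₃ ×2 printed «UND:HF-candidate(…)+UND:MIXED+EPH»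
(`other 1` leading, coded under v1.9 item 17) against «EPH | EPH+UND:STRUCT» ⇒ PARTIAL — EPH rides (body pre-named, head not). [folklore] -/
theorem v8late_prints_0828 : score [undMixed, eph] [[eph]] = .PARTIAL
    ∧ score [undMultiorb] [[undMultiorb], [undMultiorb, undStruct]] = .AGREE
    ∧ score [bi] [[eph], [eph, undStruct], [bi]] = .AGREE
    ∧ score [bh1, be3, bh1, be3] [[bh1], [bh1, undMultiorb], [undMultiorb]] = .AGREE
    ∧ score [other 1, undMixed, eph] [[eph], [eph, undStruct]] = .PARTIAL := by decide

end RouterScore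

end Summit.Ventures.CertifiedManyBodySolver.Downfold
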